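import Literature.Dynamics.SymbolicDynamics.Hochman2025Kept
import HarnessLib

/-!
# Hochman 2025, §6.3 Claims 6.2–6.5: the relocated witnesses of the kept frames are safe

Continuation of `Hochman2025Kept.lean` (§6.3 Steps A–B of M. Hochman, *Irreducibility and
periodicity in `ℤ²` symbolic systems*, Discrete Analysis 2025:17). The kept certificate
`Ckept` (kept frames of `Cx` and `Cy`, witnesses relocated to the last gap point of their safe
path) is a **valid** certificate (`Ckept_valid`): every relocated witness `w'` of a box `B` of
level `n` is safe for the NEW obstacle family `R_{Ckept}(B)`. Since `w'` lies on the safe path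
of the old family, by the locality of safety (`SafePoints.safe_mono_far`: removed members never
hurt, added members at gauge distance `> 19` neither) it suffices that every new member — a
double section of a box of a kept frame of LOWER level `k < n` of the OTHER certificate, with the
same orientation — is at gauge distance `> 19` from `w'`. This is the content of Claims 6.2–6.5
(Step A pp. 30–31, Step B pp. 31–33), which we prove in the coordinate form
`gauge_gt_of_keepX` / `gauge_gt_of_keepY`:

* `qual_geometry`: if the lower box qualifies for `B` at index `i₀` and its double section is
  gauge-close to `w' = (s, f s)`, then the centre `c''` of the lower frame sits INWARD of `w'`
  along the common axis at `Δ₁ ∈ [r_k/10 - 75 ℓ_k, r_k/10 + (i₀ + 77) ℓ_k]` with transverse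
  offset `|Δ₂| ≤ 38 h_k + r_k/25`, and `i₀ ℓ_n ≤ -r_n/10 - s + 0.775 ℓ_n` (Claim 6.5: the section
  of `w'` is about `i₀`);
* if `c''` is beyond the inner end of `B` (Case 1 of Step B: "the length of `γ′` is less than
  `2 r_k`") then `i₀ = 0` and `w'` is within `0.22 r_k` of `c''`, inside the deep zone of the lower
  frame — impossible for a witness of the other kind;
* otherwise (Claim 6.3 / Case 2) the path reaches abscissa `s + Δ₁` INWARD of `w'`, within
  `0.15 r_k` of `c''` (slope `≤ 1/10`), i.e. deep in the other zone; since the inward part of the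
  path misses the gap it lies entirely in that zone, contradicting the depth of the own centre
  (small levels) or, at large levels, the smallness of the `y`-zone (`< r_n/20`, which forces
  `i₀ ≤ S/17` and again `w'` too close to `c''`; Claim 6.4 and Case 2 of Step B).

## References

* [Hochman2025] M. Hochman, op. cit., §6.3 Step A (Claims 6.2, 6.3) and Step B (Claims 6.4, 6.5,
  Cases 1–2), pp. 29–33. Read via `lit read arxiv:2401.02273`.
-/

noncomputable section

open Set Metric Complex

namespace Literature.Dynamics.SymbolicDynamics

namespace Hochman2025

namespace Gluing

open scoped NNReal

variable {P : Params}

/-! ### Numerical consequences of the parameter inequalities -/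

/-- `ℓ_k ≤ 0.00089 r_k` (`S ≥ 1000`). [folklore] -/
theorem ℓ_le_r (hP : P.Good) (k : ℕ) : P.ℓ k ≤ 89 / 100000 * P.r k := by
  unfold Params.ℓ Params.wB
  have hS : (1000 : ℝ) ≤ P.S := by exact_mod_cast hP.S_le
  have hr := P.r_pos k
  rw [div_le_iff₀ (by linarith)]
  nlinarith

/-- `S ℓ_n = 0.89 r_n`. [folklore] -/
theorem S_mul_ℓ (hP : P.Good) (n : ℕ) : (P.S : ℝ) * P.ℓ n = 89 / 100 * P.r n := by
  unfold Params.ℓ Params.wB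
  have hS : (0 : ℝ) < P.S := by exact_mod_cast lt_of_lt_of_le (by norm_num) hP.S_le
  field_simp

/-! ### The geometry of a qualifying lower box close to a point (Claims 6.2, 6.5) -/

/-- From a gauge bound `≤ 19` for the double-section member of a lower box: the along- and
across-distances to its centre are `≤ 76 ℓ_k` and `≤ 38 h_k`. [cite: Hochman2025, §6.3 Step A
("`w' ∈ 20S`, so ... at most `20 h_k`")] -/
theorem abs_le_of_gauge_le (hP : P.Good) {n k : ℕ} (hk : 1 ≤ k) (hkn : k < n) {v : ℝ × ℝ}
    (h : SafePoints.gauge (P.famScales hP n) (k - 1) v ≤ 19) :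
    |v.1| ≤ 76 * P.ℓ k ∧ |v.2| ≤ 38 * P.h k := by
  rw [SafePoints.gauge_le_iff, Params.famScales_a hP hk hkn, Params.famScales_b hP hk hkn] at h
  have hℓ := Params.ℓ_pos hP k
  have hh := P.h_pos k
  constructor
  · have : 2 * P.h k * |v.1| ≤ 19 * (4 * P.ℓ k * (2 * P.h k)) := by nlinarith [abs_nonneg v.2]
    have : |v.1| ≤ 76 * P.ℓ k := by nlinarith
    exact this
  · have : 4 * P.ℓ k * |v.2| ≤ 19 * (4 * P.ℓ k * (2 * P.h k)) := by nlinarith [abs_nonneg v.1]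
    nlinarith

/-- Frame coordinates of frames with the same orientation differ by a translation:
`G.φ p = G'.φ p + G.φ G'.c`. [folklore] -/
theorem φ_eq_φ_add {n k : ℕ} (G : Frame P n) (G' : Frame P k) (hkk : G'.k = G.k) (p : ℂ) :
    G.φ p = G'.φ p + G.φ G'.c := by
  have hv : G'.v = G.v := Cert.v_eq_of_k_eq hkk
  simp only [Frame.φ, hv]
  rw [Plane.coords_eq_sub G.v G.c p, Plane.coords_eq_sub G.v G'.c p, Plane.coords_eq_sub G.v G.c G'.c]
  abel

/-- **The geometry of a close qualifying lower box** (Claims 6.2 and 6.5 in coordinates). Let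
`B = (G, j)` be a level-`n` box, `(G', j')` a level-`k` box (`1 ≤ k < n`, `G'` well formed) of
the same orientation qualifying for `B` at index `i₀`, and `(s, y)` a point (in the frame
coordinates of `G`) at gauge distance `≤ 19` from the double-section member `DD(i₀)`. Then with
`Δ₁ = (G.φ c').1 - s`, `Δ₂ = (G.φ c').2 - y` (`c'` the centre of `G'`):
`r_k/10 - 75 ℓ_k ≤ Δ₁ ≤ r_k/10 + (i₀ + 77) ℓ_k`, `|Δ₂| ≤ 38 h_k + r_k/25`, and
`i₀ ℓ_n ≤ -r_n/10 - s + 0.775 ℓ_n`. [cite: Hochman2025, §6.3 Claims 6.2, 6.5] -/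
theorem qual_geometry (hP : P.Good) {n k : ℕ} (hk : 1 ≤ k) (hkn : k < n) (G : Frame P n)
    (j : Fin (P.N n)) {G' : Frame P k} (hG' : G'.WF) (hkk : G'.k = G.k) (j' : Fin (P.N k))
    (i₀ : Fin P.S) (hq : Cert.Qual G j G' j' i₀) {s y : ℝ}
    (hg : SafePoints.gauge (P.famScales hP n) (k - 1) ((s, y) - (Cert.ddDiamond G G' j' i₀).c) ≤ 19) :
    P.r k / 10 - 75 * P.ℓ k ≤ (G.φ G'.c).1 - s ∧
      (G.φ G'.c).1 - s ≤ P.r k / 10 + (((i₀ : ℕ) : ℝ) + 77) * P.ℓ k ∧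
      |(G.φ G'.c).2 - y| ≤ 38 * P.h k + P.r k / 25 ∧
      ((i₀ : ℕ) : ℝ) * P.ℓ n ≤ -(P.r n / 10) - s + 775 / 1000 * P.ℓ n := by
  obtain ⟨h1, h2⟩ := abs_le_of_gauge_le hP hk hkn hg
  simp only [Cert.ddDiamond, Prod.fst_sub, Prod.snd_sub] at h1 h2
  rw [abs_le] at h1 h2
  -- the common point of `2R(i₀)` and `B(i₀)`
  obtain ⟨p, hp2, hp⟩ := hq
  obtain ⟨hp1a, hp1b, -, -⟩ := hp
  obtain ⟨hq1a, hq1b, hq2a, hq2b⟩ := hp2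
  have hℓn : 89 / 100 * P.r n / P.S = P.ℓ n := rfl
  have hℓk : 89 / 100 * P.r k / P.S = P.ℓ k := rfl
  rw [hℓn] at hp1a hp1b
  rw [hℓk] at hq1a hq1b
  have hφ := φ_eq_φ_add G G' hkk p
  have hφ1 : (G.φ p).1 = (G'.φ p).1 + (G.φ G'.c).1 := by rw [hφ]; rfl
  change _ ≤ (G'.φ p).1 at hq1a
  change (G'.φ p).1 ≤ _ at hq1b
  change _ ≤ (G.φ p).1 at hp1a
  change (G.φ p).1 ≤ _ at hp1b
  have hband := hG'.band j'
  obtain ⟨hb1, hb2⟩ := hband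
  rw [abs_le] at hb1 hb2
  have hℓkp := Params.ℓ_pos hP k
  have hℓnp := Params.ℓ_pos hP n
  have hℓkn : 100 * P.ℓ k < P.ℓ n := by
    have h1 := Params.r_lt_ℓ hP hkn
    have h2 := Params.ℓ_le_wB hP k
    unfold Params.wB at h2
    have h3 := P.r_pos k
    linarith
  have hi0 : 0 ≤ ((i₀ : ℕ) : ℝ) * P.ℓ k := mul_nonneg (Nat.cast_nonneg _) hℓkp.le
  refine ⟨by linarith, by linarith, ?_, ?_⟩
  · rw [abs_le]; constructor <;> linarith
  · -- `(G.φ p).1 ≥ s - 76.5 ℓ_k ≥ s - 0.765 ℓ_n` and `(G.φ p).1 ≤ -r_n/10 - i₀ ℓ_n`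
    linarith

/-- The distance from a curve point to a point is controlled by the coordinate differences.
[folklore] -/
theorem norm_curve_sub_le' {n : ℕ} (G : Frame P n) (f : ℝ → ℝ) (s : ℝ) (q : ℂ) :
    ‖G.curve f s - q‖ ≤ |(G.φ q).1 - s| + |(G.φ q).2 - f s| := by
  have := G.norm_curve_sub_le f s q
  rw [abs_sub_comm ((G.φ q).1), abs_sub_comm ((G.φ q).2)]
  exact this

/-! ### The two claims -/

section Claims

variable {J : Finset (ℤ × ℤ)} {Cx Cy : Cert P}

/-- **The status of a kept `x`-witness**: `β(w') ≤ 21/2` (a moved witness is a gap point; an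
unmoved one lies, with its whole path, in the `x`-zone: at small levels because the inner end of
the box is deep in the `x`-zone, at large levels because the path is longer than the `y`-zone).
[cite: Hochman2025, §6.3 Step A (1)–(2), Claim 6.4] -/
theorem β_newW_le_of_keepX (hP : P.Good) (hJ : J.Nonempty) (hVx : Cx.Valid hP) {n : ℕ} (hn : 1 ≤ n)
    {G : Frame P n} (hG : G ∈ Cx.frames n) (hK : KeepX J n G) (j : Fin (P.N n)) :
    β J (newW J G (wpath hP hVx hn hG j) (G.w j)) ≤ 21 / 2 := by
  set f := wpath hP hVx hn hG j with hf
  have hfc : Continuous f := wpath_continuous hP hVx hn hG j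
  by_cases hne : (Tset J G f).Nonempty
  · exact le_of_eq (newW_mem_gap_of_nonempty hJ hfc hne)
  · rw [newW_of_empty hne (wpath_through hP hVx hn hG j)]
    have hwI := φ_w_fst_mem_Icc hVx hG j
    have hwcurve : G.curve f (G.φ (G.w j)).1 = G.w j := G.curve_φ_fst (wpath_through hP hVx hn hG j)
    have hr := P.r_pos n
    rcases whole_subset_U_or_V hJ hfc hne with hU | hV
    · have : G.w j ∈ U J := by rw [← hwcurve]; exact hU ⟨_, hwI, rfl⟩
      exact le_of_lt this
    · exfalso
      -- the whole path is in `V`: impossible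
      have hin : G.curve f (-(P.r n / 10)) ∈ V J := hV ⟨_, ⟨by linarith, le_rfl⟩, rfl⟩
      rcases hK with hL | hα
      · -- large level: the path is too long for the `y`-zone
        have hout : G.curve f (-(99 / 100 * P.r n)) ∈ V J := hV ⟨_, ⟨le_rfl, by linarith⟩, rfl⟩
        have h1 := norm_sub_lt_of_V_large hJ hL hout hin
        have h2 := G.abs_sub_le_norm_curve_sub f (-(99 / 100 * P.r n)) (-(P.r n / 10))
        rw [abs_of_nonpos (by linarith)] at h2
        linarith
      · -- small level: the inner end is deep in the `x`-zone
        have hh := height_newW hVx hn hG j (s := -(P.r n / 10)) ⟨by linarith, le_rfl⟩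
        have hband := (hVx.wf.frame n G hG).band j
        rw [abs_le, abs_le] at hband
        have hdist : ‖G.curve f (-(P.r n / 10)) - G.c‖ ≤ 14 / 100 * P.r n := by
          have := G.norm_curve_sub_c_le f (-(P.r n / 10))
          rw [abs_of_nonpos (by linarith)] at this
          have hfy : |f (-(P.r n / 10))| ≤ P.r n / 25 := by
            rw [abs_le]; constructor <;> linarith [hh.1, hh.2, hband.1.1, hband.2.2, P.h_pos n]
          linarith
        have hαin : 1 ≤ α J (G.curve f (-(P.r n / 10))) := by
          have := abs_α_sub_le hJ (G.curve f (-(P.r n / 10))) G.c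
          rw [abs_le] at this
          linarith
        have := β_lt_one_of_one_le_α hαin
        have hin' : 21 / 2 < β J (G.curve f (-(P.r n / 10))) := hin
        linarith

/-- **The status of a kept `y`-witness**: `21/2 ≤ β(w')`. [cite: Hochman2025, §6.3 Step A (1)–(2)] -/
theorem le_β_newW_of_keepY (hP : P.Good) (hJ : J.Nonempty) (hVy : Cy.Valid hP) {n : ℕ} (hn : 1 ≤ n)
    {G : Frame P n} (hG : G ∈ Cy.frames n) (hK : KeepY J n G) (j : Fin (P.N n)) :
    21 / 2 ≤ β J (newW J G (wpath hP hVy hn hG j) (G.w j)) := by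
  set f := wpath hP hVy hn hG j with hf
  have hfc : Continuous f := wpath_continuous hP hVy hn hG j
  by_cases hne : (Tset J G f).Nonempty
  · exact ge_of_eq (newW_mem_gap_of_nonempty hJ hfc hne)
  · rw [newW_of_empty hne (wpath_through hP hVy hn hG j)]
    have hwI := φ_w_fst_mem_Icc hVy hG j
    have hwcurve : G.curve f (G.φ (G.w j)).1 = G.w j := G.curve_φ_fst (wpath_through hP hVy hn hG j)
    have hr := P.r_pos n
    -- the inner end is deep in the `y`-zone
    have hh := height_newW hVy hn hG j (s := -(P.r n / 10)) ⟨by linarith, le_rfl⟩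
    have hband := (hVy.wf.frame n G hG).band j
    rw [abs_le, abs_le] at hband
    have hdist : ‖G.curve f (-(P.r n / 10)) - G.c‖ ≤ 14 / 100 * P.r n := by
      have := G.norm_curve_sub_c_le f (-(P.r n / 10))
      rw [abs_of_nonpos (by linarith)] at this
      have hfy : |f (-(P.r n / 10))| ≤ P.r n / 25 := by
        rw [abs_le]; constructor <;> linarith [hh.1, hh.2, hband.1.1, hband.2.2, P.h_pos n]
      linarith
    have hβin : 21 / 2 < β J (G.curve f (-(P.r n / 10))) := by
      have := abs_β_sub_le hJ (G.curve f (-(P.r n / 10))) G.c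
      rw [abs_le] at this
      linarith [hK.2]
    rcases whole_subset_U_or_V hJ hfc hne with hU | hV
    · exfalso
      have : G.curve f (-(P.r n / 10)) ∈ U J := hU ⟨_, ⟨by linarith, le_rfl⟩, rfl⟩
      have : β J (G.curve f (-(P.r n / 10))) < 21 / 2 := this
      linarith
    · have : G.w j ∈ V J := by rw [← hwcurve]; exact hV ⟨_, hwI, rfl⟩
      exact le_of_lt this

/-- **Claims 6.2–6.5 for a kept `x`-frame**: the double-section member of a box of a kept
`y`-frame of lower level and the same orientation, qualifying for the box of a kept `x`-witness
`w'`, is at gauge distance `> 19` from `w'`. [cite: Hochman2025, §6.3 Step A (Claims 6.2, 6.3) and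
Step B (Claims 6.4, 6.5, Cases 1–2)] -/
theorem gauge_gt_of_keepX (hP : P.Good) (hJ : J.Nonempty) (hVx : Cx.Valid hP) (hVy : Cy.Valid hP)
    {n : ℕ} (hn : 1 ≤ n) {G : Frame P n} (hG : G ∈ Cx.frames n)
    (hK : KeepX J n G) (j : Fin (P.N n)) {k : ℕ} (hk : 1 ≤ k) (hkn : k < n) {G' : Frame P k}
    (hG' : G' ∈ Cy.frames k) (hK' : KeepY J k G') (hkk : G'.k = G.k) (j' : Fin (P.N k))
    (i₀ : Fin P.S) (hq : Cert.Qual G j G' j' i₀) :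
    19 < SafePoints.gauge (P.famScales hP n) (k - 1)
      (G.φ (newW J G (wpath hP hVx hn hG j) (G.w j)) - (Cert.ddDiamond G G' j' i₀).c) := by
  set f := wpath hP hVx hn hG j with hf
  have hfc : Continuous f := wpath_continuous hP hVx hn hG j
  set s := sStar J G f (G.w j) with hs
  have hφw : G.φ (newW J G f (G.w j)) = (s, f s) := φ_newW (G.w j)
  rw [hφw]
  by_contra hle
  push Not at hle
  obtain ⟨hΔ1a, hΔ1b, hΔ2, hi₀⟩ := qual_geometry hP hk hkn G j (hVy.wf.frame k G' hG') hkk j' i₀ hq hle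
  set Δ1 := (G.φ G'.c).1 - s with hΔ1
  -- numerical facts
  have hr := P.r_pos n
  have hrk := P.r_pos k
  have hℓk := ℓ_le_r hP k
  have hℓkp := Params.ℓ_pos hP k
  have hℓnp := Params.ℓ_pos hP n
  have hhk : 10000 * P.h k ≤ P.r k := Params.h_le_r hP hk
  have hrℓ : 100 * P.r k < P.ℓ n := Params.r_lt_ℓ hP hkn
  have hSℓ := S_mul_ℓ hP n
  have hSℓk := S_mul_ℓ hP k
  have hi₀S : ((i₀ : ℕ) : ℝ) ≤ P.S - 1 := by
    have : (i₀ : ℕ) + 1 ≤ P.S := i₀.2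
    have : (((i₀ : ℕ) + 1 : ℕ) : ℝ) ≤ P.S := by exact_mod_cast this
    push_cast at this; linarith
  have hΔ1pos : 0 < Δ1 := by linarith
  have hΔ1le : Δ1 ≤ 106 / 100 * P.r k := by
    have h1 : (((i₀ : ℕ) : ℝ) + 77) * P.ℓ k ≤ (P.S + 76) * P.ℓ k :=
      mul_le_mul_of_nonneg_right (by linarith) hℓkp.le
    have e1 : ((P.S : ℝ) + 76) * P.ℓ k = P.S * P.ℓ k + 76 * P.ℓ k := by ring
    linarith
  -- status of the witness and depth of the lower centre
  have hβw : β J (G.curve f s) ≤ 21 / 2 := by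
    have := β_newW_le_of_keepX hP hJ hVx hn hG hK j
    rwa [newW] at this
  have hdeep : 3 / 10 * P.r k + 40 ≤ β J G'.c := hK'.2
  have hsI : s ∈ Icc (-(99 / 100 * P.r n)) (-(P.r n / 10)) :=
    sStar_mem_Icc hJ hfc (φ_w_fst_mem_Icc hVx hG j)
  by_cases hcase : s + Δ1 ≤ -(P.r n / 10)
  · -- Case I: the path passes the abscissa of `c'`, deep in the `y`-zone
    set s₁ := s + Δ1 with hs₁
    have hs₁I : s₁ ∈ Ioc s (-(P.r n / 10)) := ⟨by linarith, hcase⟩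
    have hclose : ‖G.curve f s₁ - G'.c‖ ≤ 15 / 100 * P.r k := by
      have h1 := norm_curve_sub_le' G f s₁ G'.c
      have e1 : (G.φ G'.c).1 - s₁ = 0 := by rw [hs₁, hΔ1]; ring
      rw [e1, abs_zero, zero_add] at h1
      have h2 : |(G.φ G'.c).2 - f s₁| ≤ |(G.φ G'.c).2 - f s| + |f s - f s₁| := abs_sub_le _ _ _
      have h3 := wpath_slope hP hVx hn hG j s s₁
      rw [show |s - s₁| = Δ1 by rw [hs₁, abs_sub_comm]; simp [abs_of_pos hΔ1pos]] at h3
      linarith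
    have hV₁ : G.curve f s₁ ∈ V J := by
      have := abs_β_sub_le hJ (G.curve f s₁) G'.c
      rw [abs_le] at this
      show 21 / 2 < β J (G.curve f s₁)
      linarith
    have hsub : G.curve f '' Ioc s (-(P.r n / 10)) ⊆ V J := by
      rcases inward_subset_U_or_V hJ hfc (w := G.w j) (G := G) (f := f) hsI.1 with hU | hV
      · exact absurd (hU ⟨s₁, hs₁I, rfl⟩) (fun h => Set.disjoint_left.mp disjoint_U_V h hV₁)
      · exact hV
    have hin : G.curve f (-(P.r n / 10)) ∈ V J := hsub ⟨_, ⟨lt_of_lt_of_le hs₁I.1 hcase, le_rfl⟩, rfl⟩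
    rcases hK with hL | hα
    · -- large level: the inward part is short, so `i₀` is small and `w'` is close to `c'`
      have hshort : -(P.r n / 10) - s ≤ P.r n / 20 := by
        by_contra hlt
        push Not at hlt
        set s₂ := -(P.r n / 10) - P.r n / 20 with hs₂
        have hs₂I : s₂ ∈ Ioc s (-(P.r n / 10)) := ⟨by linarith, by linarith⟩
        have h1 := norm_sub_lt_of_V_large hJ hL (hsub ⟨s₂, hs₂I, rfl⟩) hin
        have h2 := G.abs_sub_le_norm_curve_sub f s₂ (-(P.r n / 10))
        rw [hs₂, abs_of_nonpos (by linarith)] at h2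
        linarith
      have hi₀' : ((i₀ : ℕ) : ℝ) * P.ℓ n ≤ P.r n / 20 + 775 / 1000 * P.ℓ n := by linarith
      -- `i₀ ≤ S / 17.8 + 0.775` since `r_n / 20 = (S / 17.8) ℓ_n`
      have hi₀M : ((i₀ : ℕ) : ℝ) ≤ P.S / (178 / 10) + 775 / 1000 := by
        have e : (P.S : ℝ) / (178 / 10) * P.ℓ n = P.r n / 20 := by
          rw [div_mul_eq_mul_div, hSℓ]; ring
        have e2 : ((P.S : ℝ) / (178 / 10) + 775 / 1000) * P.ℓ n =
            (P.S : ℝ) / (178 / 10) * P.ℓ n + 775 / 1000 * P.ℓ n := by ring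
        have h1 : ((i₀ : ℕ) : ℝ) * P.ℓ n ≤ (P.S / (178 / 10) + 775 / 1000) * P.ℓ n := by
          rw [e2, e]; exact hi₀'
        exact le_of_mul_le_mul_right h1 hℓnp
      have hclose : ‖G.curve f s - G'.c‖ ≤ 27 / 100 * P.r k := by
        have h1 := norm_curve_sub_le' G f s G'.c
        rw [abs_of_pos hΔ1pos] at h1
        have h2 : (((i₀ : ℕ) : ℝ) + 77) * P.ℓ k ≤ (P.S / (178 / 10) + 775 / 1000 + 77) * P.ℓ k :=
          mul_le_mul_of_nonneg_right (by linarith) hℓkp.le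
        have e3 : ((P.S : ℝ) / (178 / 10) + 775 / 1000 + 77) * P.ℓ k =
            (P.S : ℝ) / (178 / 10) * P.ℓ k + (775 / 1000 + 77) * P.ℓ k := by ring
        have e4 : (P.S : ℝ) / (178 / 10) * P.ℓ k = P.r k / 20 := by
          rw [div_mul_eq_mul_div, hSℓk]; ring
        rw [e3, e4] at h2
        linarith
      have := abs_β_sub_le hJ (G.curve f s) G'.c
      rw [abs_le] at this
      linarith
    · -- small level: the inner end is deep in the `x`-zone, but it lies in `V`
      have hh := height_newW hVx hn hG j (s := -(P.r n / 10)) ⟨by linarith, le_rfl⟩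
      have hband := (hVx.wf.frame n G hG).band j
      rw [abs_le, abs_le] at hband
      have hdist : ‖G.curve f (-(P.r n / 10)) - G.c‖ ≤ 14 / 100 * P.r n := by
        have := G.norm_curve_sub_c_le f (-(P.r n / 10))
        rw [abs_of_nonpos (by linarith)] at this
        have hfy : |f (-(P.r n / 10))| ≤ P.r n / 25 := by
          rw [abs_le]; constructor <;> linarith [hh.1, hh.2, hband.1.1, hband.2.2, P.h_pos n]
        linarith
      have hαin : 1 ≤ α J (G.curve f (-(P.r n / 10))) := by
        have := abs_α_sub_le hJ (G.curve f (-(P.r n / 10))) G.c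
        rw [abs_le] at this
        linarith
      have := β_lt_one_of_one_le_α hαin
      have hin' : 21 / 2 < β J (G.curve f (-(P.r n / 10))) := hin
      linarith
  · -- Case II: `c'` is beyond the inner end: `i₀ = 0` and `w'` is close to `c'`
    push Not at hcase
    have hi₀0 : (i₀ : ℕ) = 0 := by
      by_contra hne0
      have hge : (1 : ℝ) ≤ ((i₀ : ℕ) : ℝ) := by
        have : 1 ≤ (i₀ : ℕ) := Nat.one_le_iff_ne_zero.mpr hne0
        exact_mod_cast this
      have : P.ℓ n ≤ ((i₀ : ℕ) : ℝ) * P.ℓ n := le_mul_of_one_le_left hℓnp.le hge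
      linarith
    have hi₀r : ((i₀ : ℕ) : ℝ) = 0 := by rw [hi₀0]; simp
    rw [hi₀r] at hΔ1b
    have hclose : ‖G.curve f s - G'.c‖ ≤ 22 / 100 * P.r k := by
      have h1 := norm_curve_sub_le' G f s G'.c
      rw [abs_of_pos hΔ1pos] at h1
      linarith
    have := abs_β_sub_le hJ (G.curve f s) G'.c
    rw [abs_le] at this
    linarith

/-- **Claims 6.2–6.3 for a kept `y`-frame** (symmetric: members from kept `x`-frames of lower
level). [cite: Hochman2025, §6.3 Step A (Claims 6.2, 6.3)] -/
theorem gauge_gt_of_keepY (hP : P.Good) (hJ : J.Nonempty) (hVx : Cx.Valid hP) (hVy : Cy.Valid hP)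
    {n : ℕ} (hn : 1 ≤ n) {G : Frame P n} (hG : G ∈ Cy.frames n)
    (hK : KeepY J n G) (j : Fin (P.N n)) {k : ℕ} (hk : 1 ≤ k) (hkn : k < n) {G' : Frame P k}
    (hG' : G' ∈ Cx.frames k) (hK' : KeepX J k G') (hkk : G'.k = G.k) (j' : Fin (P.N k))
    (i₀ : Fin P.S) (hq : Cert.Qual G j G' j' i₀) :
    19 < SafePoints.gauge (P.famScales hP n) (k - 1)
      (G.φ (newW J G (wpath hP hVy hn hG j) (G.w j)) - (Cert.ddDiamond G G' j' i₀).c) := by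
  set f := wpath hP hVy hn hG j with hf
  have hfc : Continuous f := wpath_continuous hP hVy hn hG j
  set s := sStar J G f (G.w j) with hs
  have hφw : G.φ (newW J G f (G.w j)) = (s, f s) := φ_newW (G.w j)
  rw [hφw]
  by_contra hle
  push Not at hle
  obtain ⟨hΔ1a, hΔ1b, hΔ2, hi₀⟩ := qual_geometry hP hk hkn G j (hVx.wf.frame k G' hG') hkk j' i₀ hq hle
  set Δ1 := (G.φ G'.c).1 - s with hΔ1
  have hr := P.r_pos n
  have hrk := P.r_pos k
  have hℓk := ℓ_le_r hP k
  have hℓkp := Params.ℓ_pos hP k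
  have hℓnp := Params.ℓ_pos hP n
  have hhk : 10000 * P.h k ≤ P.r k := Params.h_le_r hP hk
  have hrℓ : 100 * P.r k < P.ℓ n := Params.r_lt_ℓ hP hkn
  have hSℓk := S_mul_ℓ hP k
  have hi₀S : ((i₀ : ℕ) : ℝ) ≤ P.S - 1 := by
    have : (i₀ : ℕ) + 1 ≤ P.S := i₀.2
    have : (((i₀ : ℕ) + 1 : ℕ) : ℝ) ≤ P.S := by exact_mod_cast this
    push_cast at this; linarith
  have hΔ1pos : 0 < Δ1 := by linarith
  have hΔ1le : Δ1 ≤ 106 / 100 * P.r k := by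
    have h1 : (((i₀ : ℕ) : ℝ) + 77) * P.ℓ k ≤ (P.S + 76) * P.ℓ k :=
      mul_le_mul_of_nonneg_right (by linarith) hℓkp.le
    have e1 : ((P.S : ℝ) + 76) * P.ℓ k = P.S * P.ℓ k + 76 * P.ℓ k := by ring
    linarith
  -- status of the witness; depth of the lower (`x`-kept) centre: small level since `k < n` small
  have hβw : 21 / 2 ≤ β J (G.curve f s) := by
    have := le_β_newW_of_keepY hP hJ hVy hn hG hK j
    rwa [newW] at this
  have hdeep : 3 / 10 * P.r k + 40 ≤ α J G'.c := by
    rcases hK' with hL | h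
    · exact absurd (hL.mono hP hkn.le) hK.1
    · exact h
  have hsI : s ∈ Icc (-(99 / 100 * P.r n)) (-(P.r n / 10)) :=
    sStar_mem_Icc hJ hfc (φ_w_fst_mem_Icc hVy hG j)
  by_cases hcase : s + Δ1 ≤ -(P.r n / 10)
  · -- Case I
    set s₁ := s + Δ1 with hs₁
    have hs₁I : s₁ ∈ Ioc s (-(P.r n / 10)) := ⟨by linarith, hcase⟩
    have hclose : ‖G.curve f s₁ - G'.c‖ ≤ 15 / 100 * P.r k := by
      have h1 := norm_curve_sub_le' G f s₁ G'.c
      have e1 : (G.φ G'.c).1 - s₁ = 0 := by rw [hs₁, hΔ1]; ring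
      rw [e1, abs_zero, zero_add] at h1
      have h2 : |(G.φ G'.c).2 - f s₁| ≤ |(G.φ G'.c).2 - f s| + |f s - f s₁| := abs_sub_le _ _ _
      have h3 := wpath_slope hP hVy hn hG j s s₁
      rw [show |s - s₁| = Δ1 by rw [hs₁, abs_sub_comm]; simp [abs_of_pos hΔ1pos]] at h3
      linarith
    have hU₁ : G.curve f s₁ ∈ U J := by
      have := abs_α_sub_le hJ (G.curve f s₁) G'.c
      rw [abs_le] at this
      have hα₁ : 1 ≤ α J (G.curve f s₁) := by linarith
      have := β_lt_one_of_one_le_α hα₁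
      show β J (G.curve f s₁) < 21 / 2
      linarith
    have hsub : G.curve f '' Ioc s (-(P.r n / 10)) ⊆ U J := by
      rcases inward_subset_U_or_V hJ hfc (w := G.w j) (G := G) (f := f) hsI.1 with hU | hV
      · exact hU
      · exact absurd (hV ⟨s₁, hs₁I, rfl⟩) (fun h => Set.disjoint_left.mp disjoint_U_V hU₁ h)
    have hin : G.curve f (-(P.r n / 10)) ∈ U J := hsub ⟨_, ⟨lt_of_lt_of_le hs₁I.1 hcase, le_rfl⟩, rfl⟩
    -- but the inner end is deep in the `y`-zone
    have hh := height_newW hVy hn hG j (s := -(P.r n / 10)) ⟨by linarith, le_rfl⟩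
    have hband := (hVy.wf.frame n G hG).band j
    rw [abs_le, abs_le] at hband
    have hdist : ‖G.curve f (-(P.r n / 10)) - G.c‖ ≤ 14 / 100 * P.r n := by
      have := G.norm_curve_sub_c_le f (-(P.r n / 10))
      rw [abs_of_nonpos (by linarith)] at this
      have hfy : |f (-(P.r n / 10))| ≤ P.r n / 25 := by
        rw [abs_le]; constructor <;> linarith [hh.1, hh.2, hband.1.1, hband.2.2, P.h_pos n]
      linarith
    have := abs_β_sub_le hJ (G.curve f (-(P.r n / 10))) G.c
    rw [abs_le] at this
    have hin' : β J (G.curve f (-(P.r n / 10))) < 21 / 2 := hin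
    linarith [hK.2]
  · -- Case II
    push Not at hcase
    have hi₀0 : (i₀ : ℕ) = 0 := by
      by_contra hne0
      have hge : (1 : ℝ) ≤ ((i₀ : ℕ) : ℝ) := by
        have : 1 ≤ (i₀ : ℕ) := Nat.one_le_iff_ne_zero.mpr hne0
        exact_mod_cast this
      have : P.ℓ n ≤ ((i₀ : ℕ) : ℝ) * P.ℓ n := le_mul_of_one_le_left hℓnp.le hge
      linarith
    have hi₀r : ((i₀ : ℕ) : ℝ) = 0 := by rw [hi₀0]; simp
    rw [hi₀r] at hΔ1b
    have hclose : ‖G.curve f s - G'.c‖ ≤ 22 / 100 * P.r k := by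
      have h1 := norm_curve_sub_le' G f s G'.c
      rw [abs_of_pos hΔ1pos] at h1
      linarith
    have := abs_α_sub_le hJ (G.curve f s) G'.c
    rw [abs_le] at this
    have hα : 1 ≤ α J (G.curve f s) := by linarith
    have := β_lt_one_of_one_le_α hα
    linarith

/-! ### Validity of the kept certificate -/

/-- Lower members of the kept certificate coming from a kept frame of the same certificate are
members of the old family. [folklore] -/
theorem ddDiamond_reloc_mem (hP : P.Good) {C : Cert P} (hV : C.Valid hP) {n : ℕ} (hn : 1 ≤ n) {G : Frame P n}
    (hG : G ∈ C.frames n) (j : Fin (P.N n)) {k : ℕ} (hk : 1 ≤ k ∧ k < n) {G' : Frame P k}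
    (hG' : G' ∈ C.frames k) (hkk : G'.k = G.k) (j' : Fin (P.N k))
    (h : ∃ i, Cert.Qual (relocFrame hP J hV hn G hG) j (relocFrame hP J hV hk.1 G' hG') j' i) :
    Cert.ddDiamond (relocFrame hP J hV hn G hG) (relocFrame hP J hV hk.1 G' hG') j'
        (Cert.qualIdx (relocFrame hP J hV hn G hG) j (relocFrame hP J hV hk.1 G' hG') j' h) ∈
      C.familySet G j := by
  have hsg := relocFrame_sameGeom (J := J) hV hn G hG
  have hsg' := relocFrame_sameGeom (J := J) hV hk.1 G' hG'
  have hiff : ∀ s, Cert.Qual (relocFrame hP J hV hn G hG) j (relocFrame hP J hV hk.1 G' hG') j' s ↔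
      Cert.Qual G j G' j' s := by
    intro s
    unfold Cert.Qual
    rw [← hsg.sect_eq, ← hsg'.sect2_eq]
  have h' : ∃ s, Cert.Qual G j G' j' s := by obtain ⟨s, hs⟩ := h; exact ⟨s, (hiff s).mp hs⟩
  right
  refine ⟨k, hk, G', hG', hkk, j', h', ?_⟩
  rw [Cert.qualIdx_congr hiff h h']
  simp only [Cert.ddDiamond, relocFrame_φ, relocFrame_c, relocFrame_t]

/-- **The kept certificate has safe witnesses.** [cite: Hochman2025, §6.3 Steps A–B
("We have shown that `C ∪ {F'}` is a certificate")] -/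
theorem Ckept_witSafe (hP : P.Good) (hJ : J.Nonempty) (hVx : Cx.Valid hP) (hVy : Cy.Valid hP) :
    (Ckept hP J hVx hVy).WitSafe hP := by
  intro n hn F hF j 𝔉 h𝔉
  have hgood := Params.famScales_good hP n
  rcases mem_Ckept.mp hF with ⟨hn', G, hG, hK, rfl⟩ | ⟨hn', G, hG, hK, rfl⟩
  · -- a kept `x`-frame
    set 𝔉₀ := (Cert.familySet_finite hP hVx.wf hG j).toFinset with h𝔉₀
    have hcoe : (↑𝔉₀ : Set SafePoints.Diamond) = Cx.familySet G j := Set.Finite.coe_toFinset _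
    have hsafe₀ := wpath_safe hP hVx hn' hG j 𝔉₀ hcoe (sStar J G (wpath hP hVx hn' hG j) (G.w j))
    rw [relocFrame_φ]
    change G.φ (newW J G (wpath hP hVx hn' hG j) (G.w j)) ∈ _
    rw [φ_newW]
    refine SafePoints.safe_mono_far hgood hsafe₀ fun A hA hA₀ => ?_
    have hA' : A ∈ (Ckept hP J hVx hVy).familySet (relocFrame hP J hVx hn' G hG) j := by
      rw [← h𝔉]; exact hA
    have hA₀' : A ∉ Cx.familySet G j := by rw [← hcoe]; exact hA₀
    rcases hA' with hstrip | ⟨k, hk, F', hF', hkk, j', h, rfl⟩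
    · exfalso; apply hA₀'
      left
      simpa [Cert.stripDiamonds, Cert.stripLo, Cert.stripHi, relocFrame_t] using hstrip
    · rcases mem_Ckept.mp hF' with ⟨hk1, G', hG', hK', rfl⟩ | ⟨hk1, G', hG', hK', rfl⟩
      · exfalso; apply hA₀'
        have := ddDiamond_reloc_mem hP hVx hn' hG j hk hG' hkk j' h
        convert this using 2
      · -- a member from a kept `y`-frame: Claims
        have hq := Cert.qual_qualIdx (relocFrame hP J hVx hn' G hG) j (relocFrame hP J hVy hk1 G' hG') j' h
        set i₀ := Cert.qualIdx (relocFrame hP J hVx hn' G hG) j (relocFrame hP J hVy hk1 G' hG') j' h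
        have hq' : Cert.Qual G j G' j' i₀ := by
          unfold Cert.Qual at hq ⊢
          rwa [← (relocFrame_sameGeom (J := J) hVx hn' G hG).sect_eq, ← (relocFrame_sameGeom (J := J) hVy hk1 G' hG').sect2_eq] at hq
        have hkk' : G'.k = G.k := hkk
        have key := gauge_gt_of_keepX hP hJ hVx hVy hn' hG hK j hk.1 hk.2 hG' hK' hkk' j' i₀ hq'
        rw [φ_newW] at key
        have hdd : Cert.ddDiamond (relocFrame hP J hVx hn' G hG) (relocFrame hP J hVy hk1 G' hG') j' i₀ =
            Cert.ddDiamond G G' j' i₀ := by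
          simp only [Cert.ddDiamond, relocFrame_φ, relocFrame_c, relocFrame_t]
        rw [hdd]
        exact key
  · -- a kept `y`-frame
    set 𝔉₀ := (Cert.familySet_finite hP hVy.wf hG j).toFinset with h𝔉₀
    have hcoe : (↑𝔉₀ : Set SafePoints.Diamond) = Cy.familySet G j := Set.Finite.coe_toFinset _
    have hsafe₀ := wpath_safe hP hVy hn' hG j 𝔉₀ hcoe (sStar J G (wpath hP hVy hn' hG j) (G.w j))
    rw [relocFrame_φ]
    change G.φ (newW J G (wpath hP hVy hn' hG j) (G.w j)) ∈ _
    rw [φ_newW]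
    refine SafePoints.safe_mono_far hgood hsafe₀ fun A hA hA₀ => ?_
    have hA' : A ∈ (Ckept hP J hVx hVy).familySet (relocFrame hP J hVy hn' G hG) j := by
      rw [← h𝔉]; exact hA
    have hA₀' : A ∉ Cy.familySet G j := by rw [← hcoe]; exact hA₀
    rcases hA' with hstrip | ⟨k, hk, F', hF', hkk, j', h, rfl⟩
    · exfalso; apply hA₀'
      left
      simpa [Cert.stripDiamonds, Cert.stripLo, Cert.stripHi, relocFrame_t] using hstrip
    · rcases mem_Ckept.mp hF' with ⟨hk1, G', hG', hK', rfl⟩ | ⟨hk1, G', hG', hK', rfl⟩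
      · -- a member from a kept `x`-frame: Claims
        have hq := Cert.qual_qualIdx (relocFrame hP J hVy hn' G hG) j (relocFrame hP J hVx hk1 G' hG') j' h
        set i₀ := Cert.qualIdx (relocFrame hP J hVy hn' G hG) j (relocFrame hP J hVx hk1 G' hG') j' h
        have hq' : Cert.Qual G j G' j' i₀ := by
          unfold Cert.Qual at hq ⊢
          rwa [← (relocFrame_sameGeom (J := J) hVy hn' G hG).sect_eq, ← (relocFrame_sameGeom (J := J) hVx hk1 G' hG').sect2_eq] at hq
        have hkk' : G'.k = G.k := hkk
        have key := gauge_gt_of_keepY hP hJ hVx hVy hn' hG hK j hk.1 hk.2 hG' hK' hkk' j' i₀ hq'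
        rw [φ_newW] at key
        have hdd : Cert.ddDiamond (relocFrame hP J hVy hn' G hG) (relocFrame hP J hVx hk1 G' hG') j' i₀ =
            Cert.ddDiamond G G' j' i₀ := by
          simp only [Cert.ddDiamond, relocFrame_φ, relocFrame_c, relocFrame_t]
        rw [hdd]
        exact key
      · exfalso; apply hA₀'
        have := ddDiamond_reloc_mem hP hVy hn' hG j hk hG' hkk j' h
        convert this using 2

/-- **The kept certificate is a valid certificate.** [cite: Hochman2025, §6.3 Steps A–B] -/
theorem Ckept_valid (hP : P.Good) (hJ : J.Nonempty) (hVx : Cx.Valid hP) (hVy : Cy.Valid hP) :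
    (Ckept hP J hVx hVy).Valid hP :=
  ⟨Ckept_wf hJ, Ckept_witSafe hP hJ hVx hVy⟩

end Claims

end Gluing

end Hochman2025

end Literature.Dynamics.SymbolicDynamics
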